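import Summits.Ventures.ResidMod.InstanceKit
import HarnessLib

/-!
# Venture ResidMod — shared separability certificates for the census rows' Euler factors (DIST0 slots)

HONEST FRAMING. Theorems only: for each Euler factor `L_p(T) = 1 − aT + bT² − paT³ + p²T⁴` occurring at
`p = 2` (T-2 rows) or `p = 3` (T-L rows) of the census and not already certified in a landed row file, the
statement "`L_p(T)` is separable over `ℚ`" proved by an integer Bézout identity `U·L + V·L' = N` checked by
`ring` (`InstanceKit.separable_of_intBezout`). Used by the keyed row bundles `RowsT2K_*`, `RowsTLK_*` (one
lemma per DISTINCT `(p,a,b)`: the statement does not depend on the curve). No claim about any surface.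
[BoxerCalegariGeePilloni2025, Def. 9.1.2 ("Q(x) is not a square" ⟸ separable)].
-/

noncomputable section

namespace Summit.Ventures.ResidMod

open Polynomial
open Literature.NumberTheory.FaltingsSerre

/-- `L_2 = 1 − (0)T + (-1)T² − 2·(0)T³ + 4T⁴` is separable over `ℚ`: `(30 + 16 * X ^ 2)·L + (-7 * X - 4 * X ^ 3)·L' = 30`.
[cite: BoxerCalegariGeePilloni2025, Def. 9.1.2] -/
theorem sep_L2_0_m1 : ((lPolynomialOfSurface 2 (0) (-1)).map (Int.castRingHom ℚ)).Separable := by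
  apply separable_of_intBezout (U := 30 + 16 * X ^ 2) (V := -7 * X - 4 * X ^ 3) (N := 30) (by norm_num)
  rw [derivative_map_lPolynomialOfSurface_eq, map_lPolynomialOfSurface_eq]
  push_cast
  ring

/-- `L_2 = 1 − (2)T + (3)T² − 2·(2)T³ + 4T⁴` is separable over `ℚ`: `(70 + 108 * X + 48 * X ^ 2)·L + (1 - 13 * X - 24 * X ^ 2 - 12 * X ^ 3)·L' = 68`.
[cite: BoxerCalegariGeePilloni2025, Def. 9.1.2] -/
theorem sep_L2_2_3 : ((lPolynomialOfSurface 2 (2) (3)).map (Int.castRingHom ℚ)).Separable := by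
  apply separable_of_intBezout (U := 70 + 108 * X + 48 * X ^ 2) (V := 1 - 13 * X - 24 * X ^ 2 - 12 * X ^ 3) (N := 68) (by norm_num)
  rw [derivative_map_lPolynomialOfSurface_eq, map_lPolynomialOfSurface_eq]
  push_cast
  ring

/-- `L_3 = 1 − (-3)T + (7)T² − 3·(-3)T³ + 9T⁴` is separable over `ℚ`: `(53 - 1728 * X - 720 * X ^ 2)·L + (84 + 131 * X + 477 * X ^ 2 + 180 * X ^ 3)·L' = 305`.
[cite: BoxerCalegariGeePilloni2025, Def. 9.1.2] -/
theorem sep_L3_m3_7 : ((lPolynomialOfSurface 3 (-3) (7)).map (Int.castRingHom ℚ)).Separable := by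
  apply separable_of_intBezout (U := 53 - 1728 * X - 720 * X ^ 2) (V := 84 + 131 * X + 477 * X ^ 2 + 180 * X ^ 3) (N := 305) (by norm_num)
  rw [derivative_map_lPolynomialOfSurface_eq, map_lPolynomialOfSurface_eq]
  push_cast
  ring

/-- `L_3 = 1 − (-2)T + (2)T² − 3·(-2)T³ + 9T⁴` is separable over `ℚ`: `(56 - 54 * X + 180 * X ^ 2)·L + (-8 - 13 * X + 6 * X ^ 2 - 45 * X ^ 3)·L' = 40`.
[cite: BoxerCalegariGeePilloni2025, Def. 9.1.2] -/
theorem sep_L3_m2_2 : ((lPolynomialOfSurface 3 (-2) (2)).map (Int.castRingHom ℚ)).Separable := by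
  apply separable_of_intBezout (U := 56 - 54 * X + 180 * X ^ 2) (V := -8 - 13 * X + 6 * X ^ 2 - 45 * X ^ 3) (N := 40) (by norm_num)
  rw [derivative_map_lPolynomialOfSurface_eq, map_lPolynomialOfSurface_eq]
  push_cast
  ring

/-- `L_3 = 1 − (-2)T + (5)T² − 3·(-2)T³ + 9T⁴` is separable over `ℚ`: `(224 - 810 * X - 684 * X ^ 2)·L + (34 + 11 * X + 231 * X ^ 2 + 171 * X ^ 3)·L' = 292`.
[cite: BoxerCalegariGeePilloni2025, Def. 9.1.2] -/
theorem sep_L3_m2_5 : ((lPolynomialOfSurface 3 (-2) (5)).map (Int.castRingHom ℚ)).Separable := by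
  apply separable_of_intBezout (U := 224 - 810 * X - 684 * X ^ 2) (V := 34 + 11 * X + 231 * X ^ 2 + 171 * X ^ 3) (N := 292) (by norm_num)
  rw [derivative_map_lPolynomialOfSurface_eq, map_lPolynomialOfSurface_eq]
  push_cast
  ring

/-- `L_3 = 1 − (1)T + (1)T² − 3·(1)T³ + 9T⁴` is separable over `ℚ`: `(791 + 576 * X + 144 * X ^ 2)·L + (14 - 187 * X - 141 * X ^ 2 - 36 * X ^ 3)·L' = 777`.
[cite: BoxerCalegariGeePilloni2025, Def. 9.1.2] -/
theorem sep_L3_1_1 : ((lPolynomialOfSurface 3 (1) (1)).map (Int.castRingHom ℚ)).Separable := by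
  apply separable_of_intBezout (U := 791 + 576 * X + 144 * X ^ 2) (V := 14 - 187 * X - 141 * X ^ 2 - 36 * X ^ 3) (N := 777) (by norm_num)
  rw [derivative_map_lPolynomialOfSurface_eq, map_lPolynomialOfSurface_eq]
  push_cast
  ring

/-- `L_3 = 1 − (1)T + (2)T² − 3·(1)T³ + 9T⁴` is separable over `ℚ`: `(440 + 351 * X - 252 * X ^ 2)·L + (-2 - 97 * X - 93 * X ^ 2 + 63 * X ^ 3)·L' = 442`.
[cite: BoxerCalegariGeePilloni2025, Def. 9.1.2] -/
theorem sep_L3_1_2 : ((lPolynomialOfSurface 3 (1) (2)).map (Int.castRingHom ℚ)).Separable := by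
  apply separable_of_intBezout (U := 440 + 351 * X - 252 * X ^ 2) (V := -2 - 97 * X - 93 * X ^ 2 + 63 * X ^ 3) (N := 442) (by norm_num)
  rw [derivative_map_lPolynomialOfSurface_eq, map_lPolynomialOfSurface_eq]
  push_cast
  ring

end Summit.Ventures.ResidMod

end
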